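import Summits.QuantumFields.YangMills.Theorems.UnitScaleTiltProp7NumericWindowsInhabitedV5
import HarnessLib

/-!
# Route `UnitScaleTilt`, crux K1 child «MinimiserStabilityRegPr» (stmt-QuantumFields-19200), stub `stub_existenceMinimalOrbit` (EX), route (α) — **«NUMERICS-CENSUS» AT THE S31ᴸ LETTERS (`hC157` DISCHARGED: `g ↦ 10¹¹·L⁵`), KNIT-READY:
# the display's 21 L-only windows + 6 positivity binders (texts VERBATIM = S26ᴸ…S30ᴸ, ✓p696187) + ★px18's C-entry windows `hWe'' hWε''` (for the `hC157` S-step) + `hαcap : α L ≤ ecap L`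
# for an arbitrary positive supplier threshold `ecap`** — all jointly inhabited for every block size and all admissible letters `B₀ p139 CH δH CΔ δΔ C349 δ349 CKπ δKπ CKΔ δKΔ CC δC` (display of record S31ᴸ ✓p703595, EX namer ★w2-19200 g8 2026-08-29T06:41:35Z «px14 g4: confirm v4's window TEXTS == S31ᴸ by script, or re-cut S31»: ★px18 ✓p703125 `hC157_family` fixes `g L := 10 ^ 11 * (L : ℝ) ^ 5`, so `g`∕`hg0`∕`hC157` left the display, `hWe'' hWε''` entered, and every `g L` reads `(10 ^ 11 * (L : ℝ) ^ 5)` in `hqΘ hC4 hMdoor` — all 43 numeric∕sign binders of S31ᴸ matched VERBATIM by script).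
# PROOF = ✓`numericWindows_inhabited_family_v5` (p702133) at the eight letter formulas (`cC c137 k349 c137π := 3·C·(2(1+1∕δ))³`, `ΘH := 3·CH·(2(1+2∕δH))³`, `ΘΔ := 3·CΔ·(2(1+1∕δΔ))³`, `G := 6·(10¹¹L⁵)`;
# α-dependent `kTJ := 12·α·ΘH·10¹¹L⁵`, `k139π := 12·α·p139` at `α := 1`) + `gcongr` with `α ≤ 1` in `hC4` (two slots) and `hMdoor` (two slots) — the S26P recipe.

Cell `ym3-torus`, width seat `ym3-torus-px14` (gen 4).  THEOREMS ONLY (0 `def`, 0 `sorry`); `--supports stmt-QuantumFields-19200 --as helper`; count-neutral.  YM₃ on T³ is a ladder rung (R3),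
NOT the Clay problem; nothing here claims the stub, the crux, d = 4 or the mass gap.  PURE REAL ARITHMETIC.  HONEST SCOPE: arithmetic only; nothing about the letters' suppliers.

References: T. Bałaban, CMP **102** (1985) 277–309 [Balaban1985Variational] (Thm 1 p.279, (70)–(77) pp.289–290, Prop. 4 (97)–(98) pp.292–293, (118)–(121) p.295, (136)–(140) pp.298–299);
CMP **99** (1985) 389–434 [Balaban1985BackgroundPropagators] ((3.49) p.399, (3.133) p.422, (3.138)–(3.139) p.423); CMP **98** (1985) 17–51 [Balaban1985Averaging] (Prop. 5 (157) p.42).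
-/

set_option autoImplicit false

noncomputable section

namespace Summit.QuantumFields.YangMills.Theorems.Prop7NumericWindowsInhabited

set_option maxHeartbeats 400000 in
/-- ★★★ **«NUMERICS-CENSUS» AT THE S31ᴸ LETTERS (`g ↦ 10¹¹·L⁵`), KNIT-READY — the display's twenty-one L-only windows + six positivity binders (VERBATIM), the two C-entry windows `hWe'' hWε''` and the supplier cap
`hαcap : α L ≤ ecap L` are jointly inhabited by explicit `ef α a₃ r ε′ εC C₄ M`**, for all admissible letters and every `ecap > 0` (module docstring).  Proof: ✓`numericWindows_inhabited_family_v5` at the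
formulas (`kTJ`, `k139π` at `α := 1`), then `α ≤ 1` by `gcongr` in `hC4` and `hMdoor`. [cite: Balaban1985Variational, Thm 1 p.279, (70)–(77) pp.289–290, Prop. 4 (97)–(98) pp.292–293, (118)–(121)
p.295, (136)–(140) pp.298–299] -/
theorem numericWindows_inhabited_family_S31C
    (B₀ p139 CH δH CΔ δΔ C349 δ349 CKπ δKπ CKΔ δKΔ CC δC : ℕ → ℝ)
    (hB₀ : ∀ L, 1 < L → 0 < B₀ L)
    (hCH : ∀ L, 1 < L → 0 ≤ CH L)
    (hδH : ∀ L, 1 < L → 0 < δH L)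
    (hCΔ : ∀ L, 1 < L → 0 ≤ CΔ L)
    (hδΔ : ∀ L, 1 < L → 0 < δΔ L)
    (hp139 : ∀ L : ℕ, 1 < L → 0 ≤ p139 L)
    (hC349 : ∀ L, 1 < L → 0 ≤ C349 L)
    (hδ349 : ∀ L, 1 < L → 0 < δ349 L)
    (hCKπ : ∀ L, 1 < L → 0 ≤ CKπ L)
    (hδKπ : ∀ L, 1 < L → 0 < δKπ L)
    (hCKΔ : ∀ L, 1 < L → 0 ≤ CKΔ L)
    (hδKΔ : ∀ L, 1 < L → 0 < δKΔ L)
    (hCC : ∀ L, 1 < L → 0 ≤ CC L)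
    (hδC : ∀ L, 1 < L → 0 < δC L)
    (ecap : ℕ → ℝ) (hecap : ∀ L : ℕ, 1 < L → 0 < ecap L) :
    ∃ ef α a₃ r ε' εC C₄ M : ℕ → ℝ,
      (∀ L, 1 < L → 0 < ef L) ∧
      (∀ L, 1 < L → 0 < α L) ∧
      (∀ L, 1 < L → 0 < a₃ L) ∧
      (∀ L, 1 < L → 0 < r L) ∧
      (∀ L, 1 < L → 0 < C₄ L) ∧
      (∀ L, 1 < L → 0 < M L) ∧
      (∀ L : ℕ, 1 < L → 13 * 10 ^ 14 * (L : ℝ) ^ 3 * α L ≤ 1) ∧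
      (∀ L : ℕ, 1 < L → 10 ^ 9 * (L : ℝ) ^ 2 * ef L ≤ 1) ∧
      (∀ L : ℕ, 1 < L → 10 ^ 12 * (L : ℝ) ^ 3 * α L ≤ 1) ∧
      (∀ L, 1 < L → M L * α L < ef L) ∧
      (∀ L : ℕ, 1 < L → 10 ^ 7 * (L : ℝ) ^ 3 * (178 * (α L + ef L)) ≤ 1) ∧
      (∀ L : ℕ, 1 < L → 9 * (40 * (2 * (3 * (2 * ef L + 2700 * (L : ℝ) * α L))) / ef L ^ 2) * B₀ L * ε' L < 1) ∧
      (∀ L : ℕ, 1 < L → 6 * ε' L ≤ ef L) ∧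
      (∀ L : ℕ, 1 < L → 2 * (r L + 2 * B₀ L * α L) ≤ ε' L) ∧
      (∀ L : ℕ, 1 < L → 0 ≤ εC L) ∧
      (∀ L : ℕ, 1 < L → 2 * (εC L + a₃ L) ≤ ef L / 2) ∧
      (∀ L : ℕ, 1 < L → B₀ L * (40 * (2 * (3 * (2 * ef L + 2700 * (L : ℝ) * α L))) / ef L ^ 2) * (εC L + a₃ L) ^ 2 ≤ εC L) ∧
      (∀ L : ℕ, 1 < L → 4 * B₀ L * (40 * (2 * (3 * (2 * ef L + 2700 * (L : ℝ) * α L))) / ef L ^ 2) * (εC L + a₃ L) < 1) ∧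
      (∀ L : ℕ, 1 < L → 2 * B₀ L * α L ≤ r L) ∧
      (∀ L : ℕ, 1 < L → 4 * r L ≤ a₃ L) ∧
      (∀ L : ℕ, 1 < L → 16 * B₀ L * C₄ L * r L ≤ 1) ∧
      (∀ L, 1 < L → (εC L + a₃ L) * (3 * CH L * (2 * (1 + 2 / δH L)) ^ 3) * (6 * (10 ^ 11 * (L : ℝ) ^ 5)) ≤ 1 / 2) ∧
      (∀ L, 1 < L → a₃ L ≤ (1 - 4 * B₀ L * (40 * (2 * (3 * (2 * ef L + 2700 * (L : ℝ) * α L))) / ef L ^ 2) * (εC L + a₃ L)) * (1 / 16)) ∧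
      (∀ L : ℕ, 1 < L → 10 ^ 15 * (L : ℝ) ^ 2 * ef L ≤ 1) ∧
      (∀ L : ℕ, 1 < L → 10 ^ 18 * (L : ℝ) ^ 3 * α L ≤ 1) ∧
      (∀ L : ℕ, 1 < L → 10 ^ 11 * (L : ℝ) ^ 6 * ef L ≤ 1) ∧
      (∀ L : ℕ, 1 < L → 10 ^ 16 * (L : ℝ) ^ 5 * α L ≤ 1) ∧
      (∀ L : ℕ, 1 < L → α L ≤ ecap L) ∧
      (∀ L, 1 < L → 1 * 2 * ((2 * (1 / (1 - 4 * B₀ L * (40 * (2 * (3 * (2 * ef L + 2700 * (L : ℝ) * α L))) / ef L ^ 2) * (εC L + a₃ L))) + 1) * ((3 * CH L * (2 * (1 + 2 / δH L)) ^ 3) * (6 * (10 ^ 11 * (L : ℝ) ^ 5))) / a₃ L) * α L + (((3 * CKπ L * (2 * (1 + 1 / δKπ L)) ^ 3) + (12 * α L * p139 L) * B₀ L) * (40 * (2 * (3 * (2 * ef L + 2700 * (L : ℝ) * α L))) / ef L ^ 2) * (1 / (1 - 4 * B₀ L * (40 * (2 * (3 * (2 * ef L + 2700 * (L : ℝ)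 * α L))) / ef L ^ 2) * (εC L + a₃ L))) ^ 2 + 1 * 2 * (2 * (3 * CΔ L * (2 * (1 + 1 / δΔ L)) ^ 3) * (6 * (10 ^ 11 * (L : ℝ) ^ 5)) * (1 / (1 - 4 * B₀ L * (40 * (2 * (3 * (2 * ef L + 2700 * (L : ℝ) * α L))) / ef L ^ 2) * (εC L + a₃ L)))))
            + 1 * 2 * (2 * (3 * CH L * (2 * (1 + 2 / δH L)) ^ 3) * (6 * (10 ^ 11 * (L : ℝ) ^ 5)) * (1 / (1 - 4 * B₀ L * (40 * (2 * (3 * (2 * ef L + 2700 * (L : ℝ) * α L))) / ef L ^ 2) * (εC L + a₃ L)))) * (((3 * CKπ L * (2 * (1 + 1 / δKπ L)) ^ 3) + (12 * α L * p139 L) * B₀ L) * (40 * (2 * (3 * (2 * ef L + 2700 * (L : ℝ) * α L))) / ef L ^ 2) * (1 / (1 - 4 * B₀ L * (40 * (2 * (3 * (2 * ef L + 2700 * (L : ℝ) * α L))) / ef L ^ 2) * (εC L + a₃ L))) ^ 2) * a₃ L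
            + 1 * 2 * (1 + (2 * (3 * CH L * (2 * (1 + 2 / δH L)) ^ 3) * (6 * (10 ^ 11 * (L : ℝ) ^ 5)) * (1 / (1 - 4 * B₀ L * (40 * (2 * (3 * (2 * ef L + 2700 * (L : ℝ) * α L))) / ef L ^ 2) * (εC L + a₃ L)))) * a₃ L) * (2 * (1024 * ((3 - 1 : ℕ) : ℝ) * 1 * (α L + 1 / 16) + ((3 - 1 : ℕ) : ℝ) * 138 * 1)) * (1 / (1 - 4 * B₀ L * (40 * (2 * (3 * (2 * ef L + 2700 * (L : ℝ) * α L))) / ef L ^ 2) * (εC L + a₃ L))) ^ 2 ≤ C₄ L) ∧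
      (∀ L : ℕ, 1 < L → 11 * B₀ L + 4 * B₀ L * (40 * (2 * (3 * (2 * ef L + 2700 * (L : ℝ) * α L))) / ef L ^ 2) * (11 * B₀ L) ^ 2 * α L + ((1 + 25 * C₄ L * B₀ L ^ 2) + (3 * CC L * (2 * (1 + 1 / δC L)) ^ 3) * (1 + 25 * C₄ L * B₀ L ^ 2) + (3 * CKΔ L * (2 * (1 + 1 / δKΔ L)) ^ 3) * 2 + (12 * α L * (3 * CH L * (2 * (1 + 2 / δH L)) ^ 3) * (10 ^ 11 * (L : ℝ) ^ 5)) * (10 * B₀ L) / 2 + 14 * (10 * B₀ L) + (3 * C349 L * (2 * (1 + 1 / δ349 L)) ^ 3) * (10 * B₀ L) / 2 + 2 * (10 * B₀ L)) + 100 * ((3 * CKπ L * (2 * (1 + 1 / δKπ L)) ^ 3) + (12 * α L * p139 L) * B₀ L + (3 * C349 L * (2 * (1 + 1 / δ349 L)) ^ 3) * B₀ L + (28 + 4) * α L * B₀ L) * (40 * (2 * (3 * (2 * ef L + 2700 * (L : ℝ) * α L))) / ef L ^ 2) * B₀ L ^ 2 * α L ≤ M L) := by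
  classical
  have hΘH0 : ∀ L : ℕ, 1 < L → 0 ≤ (fun L => 3 * CH L * (2 * (1 + 2 / δH L)) ^ 3) L := fun L hL => by
    have := hCH L hL; have := hδH L hL; positivity
  have hΘΔ0 : ∀ L : ℕ, 1 < L → 0 ≤ (fun L => 3 * CΔ L * (2 * (1 + 1 / δΔ L)) ^ 3) L := fun L hL => by
    have := hCΔ L hL; have := hδΔ L hL; positivity
  have hG0 : ∀ L : ℕ, 1 < L → 0 ≤ (fun L => 6 * (10 ^ 11 * (L : ℝ) ^ 5)) L := fun L hL => by
    positivity
  have hk349 : ∀ L : ℕ, 1 < L → 0 ≤ (fun L => 3 * C349 L * (2 * (1 + 1 / δ349 L)) ^ 3) L := fun L hL => by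
    have := hC349 L hL; have := hδ349 L hL; positivity
  have hkTJ : ∀ L : ℕ, 1 < L → 0 ≤ (fun L => 12 * 1 * (3 * CH L * (2 * (1 + 2 / δH L)) ^ 3) * (10 ^ 11 * (L : ℝ) ^ 5)) L := fun L hL => by
    have := hCH L hL; have := hδH L hL; positivity
  have hcC : ∀ L : ℕ, 1 < L → 0 ≤ (fun L => 3 * CC L * (2 * (1 + 1 / δC L)) ^ 3) L := fun L hL => by
    have := hCC L hL; have := hδC L hL; positivity
  have hc137 : ∀ L : ℕ, 1 < L → 0 ≤ (fun L => 3 * CKΔ L * (2 * (1 + 1 / δKΔ L)) ^ 3) L := fun L hL => by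
    have := hCKΔ L hL; have := hδKΔ L hL; positivity
  have hc137π : ∀ L : ℕ, 1 < L → 0 ≤ (fun L => 3 * CKπ L * (2 * (1 + 1 / δKπ L)) ^ 3) L := fun L hL => by
    have := hCKπ L hL; have := hδKπ L hL; positivity
  have hk139 : ∀ L : ℕ, 1 < L → 0 ≤ (fun L => 12 * 1 * p139 L) L := fun L hL => by
    have := hp139 L hL; positivity
  have hk' : ∀ L : ℕ, 1 < L → 0 ≤ (fun L => 3 * CC L * (2 * (1 + 1 / δC L)) ^ 3) L ∧ 0 ≤ (fun L => 3 * CKΔ L * (2 * (1 + 1 / δKΔ L)) ^ 3) L ∧ 0 ≤ (fun L => 12 * 1 * (3 * CH L * (2 * (1 + 2 / δH L)) ^ 3) * (10 ^ 11 * (L : ℝ) ^ 5)) L ∧ 0 ≤ (fun L => 3 * C349 L * (2 * (1 + 1 / δ349 L)) ^ 3) L ∧ 0 ≤ (fun L => 3 * CKπ L * (2 * (1 + 1 / δKπ L)) ^ 3) L ∧ 0 ≤ (fun L => 12 * 1 * p139 L) L :=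
    fun L hL => ⟨hcC L hL, hc137 L hL, hkTJ L hL, hk349 L hL, hc137π L hL, hk139 L hL⟩
  obtain ⟨ef, α, a₃, r, ε', εC, C₄, M, hef, hα, ha₃, hr, hC₄, hM, hWQ, hWe, hWε, hMe, hw137, hq47, hR6, hrε2, hεC, hdomC, hselfC, hcontrC,
      hrα, hr4, hr16, hqΘ, hR16, hC4, -, hWe2, hWε2, hWe'', hWε'', hαcap, hMdoor⟩ :=
    numericWindows_inhabited_family_v5 B₀ (fun L => 3 * CC L * (2 * (1 + 1 / δC L)) ^ 3) (fun L => 3 * CKΔ L * (2 * (1 + 1 / δKΔ L)) ^ 3) (fun L => 12 * 1 * (3 * CH L * (2 * (1 + 2 / δH L)) ^ 3) * (10 ^ 11 * (L : ℝ) ^ 5)) (fun L => 3 * C349 L * (2 * (1 + 1 / δ349 L)) ^ 3) (fun L => 3 * CKπ L * (2 * (1 + 1 / δKπ L)) ^ 3) (fun L => 12 * 1 * p139 L)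
      (fun L => 3 * CH L * (2 * (1 + 2 / δH L)) ^ 3) (fun L => 3 * CΔ L * (2 * (1 + 1 / δΔ L)) ^ 3) (fun L => 6 * (10 ^ 11 * (L : ℝ) ^ 5)) hB₀ hk' hΘH0 hΘΔ0 hG0 ecap hecap
  have hα1 : ∀ L : ℕ, 1 < L → α L ≤ 1 := fun L hL => by
    have hL1 : (1 : ℝ) ≤ (L : ℝ) := by exact_mod_cast hL.le
    have hw := hWε2 L hL
    have hα0 := (hα L hL).le
    nlinarith [one_le_pow₀ (n := 3) hL1]
  refine ⟨ef, α, a₃, r, ε', εC, C₄, M, hef, hα, ha₃, hr, hC₄, hM, hWQ, hWe, hWε, hMe, hw137, hq47, hR6, hrε2, hεC, hdomC, hselfC, hcontrC,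
    hrα, hr4, hr16, hqΘ, hR16, hWe2, hWε2, hWe'', hWε'', hαcap, ?_, ?_⟩
  -- hC4: the two `k139π` slots carry `α L`; the instance carries `1`
  · intro L hL
    have h := hC4 L hL
    have hB := (hB₀ L hL).le; have hp := hp139 L hL; have ha3 := (ha₃ L hL).le
    have hΘH := hΘH0 L hL; have hΘΔ := hΘΔ0 L hL; have hcπ := hc137π L hL
    have he := hef L hL; have hα0 := (hα L hL).le
    have hL0 : (0 : ℝ) < (L : ℝ) := by exact_mod_cast (lt_trans Nat.zero_lt_one hL)
    have hC₂0 : 0 ≤ 40 * (2 * (3 * (2 * ef L + 2700 * (L : ℝ) * α L))) / ef L ^ 2 := by positivity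
    have hℓ : 0 ≤ 1 / (1 - 4 * B₀ L * (40 * (2 * (3 * (2 * ef L + 2700 * (L : ℝ) * α L))) / ef L ^ 2) * (εC L + a₃ L)) :=
      div_nonneg zero_le_one (by linarith [hcontrC L hL])
    refine le_trans ?_ h
    beta_reduce at hΘH hΘΔ hcπ ⊢
    gcongr
    · exact hα1 L hL
    · exact hα1 L hL
  -- hMdoor: the `kTJ` and `k139π` slots carry `α L`
  · intro L hL
    have h := hMdoor L hL
    have hB := (hB₀ L hL).le; have hC := hCH L hL; have hδ := hδH L hL; have hp := hp139 L hL
    have he := hef L hL; have hα0 := (hα L hL).le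
    have hL0 : (0 : ℝ) < (L : ℝ) := by exact_mod_cast (lt_trans Nat.zero_lt_one hL)
    have hC₂0 : 0 ≤ 40 * (2 * (3 * (2 * ef L + 2700 * (L : ℝ) * α L))) / ef L ^ 2 := by positivity
    refine le_trans ?_ h
    gcongr
    · exact hα1 L hL
    · exact hα1 L hL
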